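import Summits.ResolutionOfSingularities.ResolutionOfSingularities.Theses.WeightedInvariant
import Literature.AlgebraicGeometry.Resolution.QuasiProjectiveReduction

/-!
# ResolutionOfSingularities / WeightedInvariant — `DatumToResolution` from `DatumToEmbedded`

Route `ResolutionOfSingularities/WeightedInvariant`, item `stmt-ResolutionOfSingularities-8974`
(`DatumToResolution`: a weighted resolution datum in characteristic `p` gives resolution of every
reduced separated scheme of finite type over every PERFECT field of characteristic `p`).

This file lands the LAYER-2 GLUE of the item. The characteristic-free, datum-free reduction lives in
`Literature/AlgebraicGeometry/Resolution/QuasiProjectiveReduction.lean`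
(`hasResolution_of_forall_closedImmersion_smooth`: over a fixed field, resolution of the integral
closed subschemes of smooth separated quasi-compact `k`-schemes — indeed of the open subschemes of
the `𝐏ⁿ_k` — gives resolution of every reduced separated `k`-scheme of finite type, by components +
Chow's lemma + the factorisation of an immersion through its open `coborderRange` + transport along
proper birational morphisms). Here:

* `datumToResolution_of_datumToEmbedded` — the route item `DatumToEmbedded` (stmt-0572: datum ⇒
  resolution of integral closed subschemes of smooth separated quasi-compact schemes over perfect
  fields of characteristic `p`) implies `DatumToResolution` (stmt-8974);
* `datumToResolution_iff_quasiProjective` — sharper: `DatumToResolution` is EQUIVALENT to the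
  QUASI-PROJECTIVE case of `DatumToEmbedded` (integral closed subschemes of open subschemes of
  `𝐏ⁿ_k`), recorded for the planner since the torus-quotient / destackification step of stmt-0572
  may use an ample line bundle.

What is NOT here: the content of `DatumToEmbedded` itself (the cobordant blow-up tower, the torus
quotient and Bergh–Rydh destackification), which is item stmt-0572; `DatumToResolution` is exactly
`DatumToEmbedded` (quasi-projective case) followed by this glue.
-/

noncomputable section

open CategoryTheory AlgebraicGeometry TopologicalSpace

set_option linter.dupNamespace false -- mandated namespace of this single-conjunct summit

namespace Summit.ResolutionOfSingularities.ResolutionOfSingularities.Theorems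

open Literature.AlgebraicGeometry Literature.AlgebraicGeometry.Resolution

/-- **`DatumToEmbedded ⇒ DatumToResolution`** (the layer-2 glue of route `WeightedInvariant`):
if a weighted resolution datum in characteristic `p` resolves every integral closed subscheme of
every smooth separated quasi-compact scheme over every perfect field of characteristic `p`
(item stmt-0572), then it resolves every reduced separated scheme of finite type over every
perfect field of characteristic `p` (item stmt-8974), by
`hasResolution_of_forall_closedImmersion_smooth`. [folklore] -/
theorem datumToResolution_of_datumToEmbedded (hE : Theses.WeightedInvariant.DatumToEmbedded) :
    Theses.WeightedInvariant.DatumToResolution := by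
  intro p hp hD k _ _ _ X f hsep hft hqc hred
  exact hasResolution_of_forall_closedImmersion_smooth
    (fun Y X' g i hg hs hq hi hint => hE p hp hD k Y X' g i hg hs hq hi hint) X f

/-- **`DatumToResolution` is EQUIVALENT to the quasi-projective case of `DatumToEmbedded`**:
`DatumToResolution` holds iff, for every prime `p` carrying a weighted resolution datum and every
perfect field `k` of characteristic `p`, every integral closed subscheme of every open subscheme
of every `𝐏ⁿ_k` has a resolution. (⇐) is
`hasResolution_of_forall_closedImmersion_opens_projectiveSpace` (components + Chow + coborder
factorisation + birational transport); (⇒) is bookkeeping — such a subscheme is a reduced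
separated `k`-scheme of finite type
(`smooth_isSeparated_quasiCompact_isRegular_opens_projectiveSpace`). Recorded for the planner:
only the quasi-projective case of item stmt-0572 is needed by this route, and weakening stmt-0572
to quasi-projective ambients loses nothing. [folklore] -/
theorem datumToResolution_iff_quasiProjective :
    Theses.WeightedInvariant.DatumToResolution ↔
      ∀ p : ℕ, p.Prime → Nonempty (WeightedResolutionDatum p) →
        ∀ (k : Type) [Field k] [CharP k p] [PerfectField k] (n : ℕ)
          (U : (Motives.projectiveSpace n k).left.Opens) (X : Scheme.{0}) (i : X ⟶ (U : Scheme.{0})),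
          IsClosedImmersion i → IsIntegral X → Scheme.HasResolution X := by
  refine ⟨fun hR p hp hD k _ _ _ n U X i hi hint => ?_,
    fun hE p hp hD k _ _ _ X f hsep hft hqc hred => ?_⟩
  · haveI := hi
    haveI := hint
    obtain ⟨_, _, _, -⟩ := smooth_isSeparated_quasiCompact_isRegular_opens_projectiveSpace n U
    exact hR p hp hD k X (i ≫ U.ι ≫ (Motives.projectiveSpace n k).hom) inferInstance inferInstance
      inferInstance inferInstance
  · exact hasResolution_of_forall_closedImmersion_opens_projectiveSpace
      (fun n U X' i hi hint => hE p hp hD k n U X' i hi hint) X f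

end Summit.ResolutionOfSingularities.ResolutionOfSingularities.Theorems

end
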